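import Mathlib
import Summits.ValiantsHypothesis.ValiantsHypothesis.Theorems.NewtonUnitEquationsDissociatedUniformStubAlphabetReduction

/-!
# A covering family for the greedy words of a planar frame (stub C'' of `DissociatedUniform`)

Words `a ∈ Fintype.piFinset A` of a frame `A : Fin m → Finset (Fin 2 →₀ ℕ)` carry a planar point `∑ j, a j`
and a Khatri–Rao column `col f a ∈ ℂ^k`.  For a direction `w` the *greedy* words are those whose column is
not in the span of the columns of strictly `w`-higher words.  We give an explicit family `𝔅` of at most
`(k*m*t+2)^4` sub-boxes `B ≤ A` with `≤ k` letters per coordinate such that for every *generic* direction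
`w` (heights separate words) every greedy word lies in the word box of a member of `𝔅` (the dissociation
hypothesis of the registered signature is not needed).

All the work is in the sibling stub file `…StubAlphabetReduction` (namespace `AlphabetReduction`): the
letter lemma `apply_mem_gr` (a greedy word has greedy letters), the bound `card ≤ k` on greedy letters
(`boxOf_code`, linear independence of a lex-first family), the fact that the greedy-letter box only depends
on the code of strict height comparisons (`boxOf_code`), and the count `ncard_codes_le` of the codes realised
along the three charts `(σ, l)`, `σ ∈ {1, -1, 0}` (`≤ 3 (m t² + 1)`).  Here `𝔅` is the image of the realised
codes under `boxOf`; `k = 0` has no greedy words (`𝔅 := ∅`). -/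

noncomputable section

open scoped BigOperators Classical

-- Sub = Summit single-conjunct layout: the duplicated namespace component is mandated by the tree.
set_option linter.dupNamespace false

namespace Summit.ValiantsHypothesis.ValiantsHypothesis.Theorems.NewtonUnitEquationsDissociatedUniform

open AlphabetReduction

namespace CoveringFamily

/-- **Covering family** (readable form): `≤ (kmt+2)^4` admissible sub-boxes whose word boxes contain every
greedy word of every direction separating the words. [folklore] -/
theorem exists_family (k m t : ℕ) (A : Fin m → Finset (Fin 2 →₀ ℕ))
    (f : Fin k → Fin m → MvPolynomial (Fin 2) ℂ) (hA : ∀ j, (A j).card ≤ t) :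
    ∃ 𝔅 : Finset (Fin m → Finset (Fin 2 →₀ ℕ)), 𝔅.card ≤ (k * m * t + 2) ^ 4 ∧
      (∀ B ∈ 𝔅, (∀ j, B j ⊆ A j) ∧ ∀ j, (B j).card ≤ k) ∧
      ∀ w : Fin 2 → ℝ, (∀ a ∈ Fintype.piFinset A, ∀ b ∈ Fintype.piFinset A,
          height w (∑ j, a j) = height w (∑ j, b j) → a = b) →
        ∀ a ∈ greedy A f w, ∃ B ∈ 𝔅, a ∈ Fintype.piFinset B := by
  rcases Nat.eq_zero_or_pos k with rfl | hk
  · refine ⟨∅, by simp, by simp, fun w _ a ha => absurd ?_ ha.2⟩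
    rw [Subsingleton.elim (col f a) 0]
    exact Submodule.zero_mem _
  have hfin := codes_finite A
  refine ⟨hfin.toFinset.image (boxOf k A f), ?_, ?_, fun w hw a ha => ?_⟩
  · refine Finset.card_image_le.trans ?_
    rw [← Set.ncard_eq_toFinset_card _ hfin]
    refine (ncard_codes_le A hA).trans ?_
    have h1 : m * t ^ 2 ≤ (k * m * t) ^ 2 := by
      nlinarith [Nat.mul_le_mul (Nat.mul_le_mul_right (t ^ 2) (Nat.le_mul_self m))
        (Nat.mul_le_mul hk hk)]
    nlinarith [h1, Nat.zero_le (k * m * t)]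
  · intro B hB
    obtain ⟨S, -, rfl⟩ := Finset.mem_image.1 hB
    exact ⟨fun j => (boxOf_subset_and_card A f S j).1, fun j => (boxOf_subset_and_card A f S j).2⟩
  · refine ⟨boxOf k A f (code A w), Finset.mem_image_of_mem _ (hfin.mem_toFinset.2 (code_mem_codes A w)),
      ?_⟩
    rw [boxOf_code f (injOn_height hw ha.1)]
    exact Fintype.mem_piFinset.2 (apply_mem_gr ha)

end CoveringFamily

/-- **Stub C'' — covering family** (registered signature of the skeleton of crux
`NewtonUnitEquations.DissociatedUniform`, line `greedy-basis-shadow`): there are `≤ (k*m*t+2)^4` sub-boxes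
of `A` with `≤ k` letters per coordinate such that, for every direction separating the words of `A`, every
greedy word lies in the word box of one of them.  The dissociation hypothesis is not needed. [folklore] -/
theorem stub_coveringFamily :
    ∃ c : ℕ, ∀ (k m t : ℕ) (A : Fin m → Finset (Fin 2 →₀ ℕ)) (f : Fin k → Fin m → MvPolynomial (Fin 2) ℂ),
      (∀ j, (A j).card ≤ t) →
      (∀ a b : Fin m → (Fin 2 →₀ ℕ), (∀ j, a j ∈ A j) → (∀ j, b j ∈ A j) → ∑ j, a j = ∑ j, b j → a = b) →
      ∃ 𝔅 : Finset (Fin m → Finset (Fin 2 →₀ ℕ)), 𝔅.card ≤ (k * m * t + 2) ^ c ∧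
        (∀ B ∈ 𝔅, (∀ j, B j ⊆ A j) ∧ ∀ j, (B j).card ≤ k) ∧
        ∀ w : Fin 2 → ℝ,
          (∀ a ∈ Fintype.piFinset A, ∀ b ∈ Fintype.piFinset A,
            (∑ i, w i * (((∑ j, a j) i : ℕ) : ℝ)) = (∑ i, w i * (((∑ j, b j) i : ℕ) : ℝ)) → a = b) →
          ∀ a ∈ {a : Fin m → (Fin 2 →₀ ℕ) | a ∈ Fintype.piFinset A ∧
              (fun i => ∏ j, (f i j).coeff (a j)) ∉ Submodule.span ℂ
                ((fun b : Fin m → (Fin 2 →₀ ℕ) => fun i => ∏ j, (f i j).coeff (b j)) ''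
                  {b | b ∈ Fintype.piFinset A ∧
                    (∑ i, w i * (((∑ j, a j) i : ℕ) : ℝ)) < ∑ i, w i * (((∑ j, b j) i : ℕ) : ℝ)})},
            ∃ B ∈ 𝔅, a ∈ Fintype.piFinset B :=
  ⟨4, fun k m t A f hA _ => CoveringFamily.exists_family k m t A f hA⟩

end Summit.ValiantsHypothesis.ValiantsHypothesis.Theorems.NewtonUnitEquationsDissociatedUniform

end
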